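import Summits.KontsevichZagierPeriods.KontsevichZagierPeriods.Theorems.SoloInformedTameMapCircleSquaring
import Summits.KontsevichZagierPeriods.KontsevichZagierPeriods.Theorems.SoloInformedTameMapSlackVolume
import HarnessLib

/-!
# No tame circle squaring, even up to null sets of overlap and deficiency

The classical dissection problems (Tarski's circle squaring, scissors congruence) let the pieces
overlap and miss parts of the figures along boundaries. This file proves COROLLARY SQ of the
`KZ_ℝ` method barrier in that generality, for NONLINEAR tame maps:

`soloInformed_isAlgebraic_volume_of_tameMapDissection`: let `D₀ ⊆ ℝⁿ` be `ℚ`-semialgebraic and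
`A i ⊆ D₀` (`i < N`) be `ℝ`-semialgebraic pieces which pairwise overlap in NULL sets and cover `D₀`
up to a NULL set; let `f i` be maps with `ℝ`-semialgebraic graphs over `A i`, injective on `A i`,
with at every point of `A i` a derivative WITHIN `A i` of determinant `±1`; if the images
`f i '' A i` lie in a real box `∏_j [0, a_j]`, pairwise overlap in null sets and cover the box up to
a null set, then `volume D₀` is algebraic over `ℚ`. Hence
`soloInformed_no_tame_circle_squaring_slack` (the closed unit disc admits no such dissection onto
any box — Lindemann) and `soloInformed_no_tameMapDissection_of_transcendental_volume`.
(For semialgebraic sets "null" and "of empty interior" are the same thing; the hypotheses are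
stated with `volume … = 0`.)

Proof: the configuration is the value at a real parameter of the universal nonlinear shape
`soloInformedTameMapShapeOf` (file `SoloInformedTameMapCircleSquaring`); SLACK validity
(`SoloInformedTameMapShape.SlackValid`, with the first-order thin-fibre clauses of
`SoloInformedTameMapSlackFamilies`) is `ℚ`-semialgebraic in the parameter and implies the volume
identity (`aeval_prod_side_eq_volume_of_slackValid`, file `SoloInformedTameMapSlackVolume`); it
holds at the true parameter (null sets have empty interior; `HasFDerivWithinAt` gives the Taylor
clause, `soloInformed_taylor_clmEntry`); conclude by
`soloInformed_realParameter_barrier_core_fintype`.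

References: Tarski (1951); [cite: Lindemann1882]; [cite: BochnakCosteRoy1998, §2.2, §5.2].
-/

noncomputable section

open Set MeasureTheory MvPolynomial Literature.ModelTheory.ExponentialFields
open Literature.NumberTheory.Transcendental

namespace Summit.KontsevichZagierPeriods.KontsevichZagierPeriods.Theorems

/-- **THEOREM (volume of a tamely dissectable set, with slack).** If a `ℚ`-semialgebraic
`D₀ ⊆ ℝⁿ` is covered up to a null set by finitely many `ℝ`-semialgebraic pieces `A i ⊆ D₀` with
null pairwise overlaps, and maps `f i` with `ℝ`-semialgebraic graphs over `A i`, injective on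
`A i`, having at every point of `A i` a derivative within `A i` of determinant `±1`, carry the
pieces into a real box `∏_j [0, a_j]` so that the images have null pairwise overlaps and cover the
box up to a null set, then `volume D₀` is an algebraic number.
[cite: BochnakCosteRoy1998, §2.2, §5.2] -/
theorem soloInformed_isAlgebraic_volume_of_tameMapDissection {n N : ℕ} {D₀ : Set (Fin n → ℝ)}
    (hD₀ : IsSemialgebraic ℚ D₀) {A : Fin N → Set (Fin n → ℝ)} (hA : ∀ i, IsSemialgebraic ℝ (A i))
    (f : Fin N → (Fin n → ℝ) → Fin n → ℝ)
    (hf : ∀ i, IsSemialgebraic ℝ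
      {v : Fin n ⊕ Fin n → ℝ | v ∘ Sum.inl ∈ A i ∧ f i (v ∘ Sum.inl) = v ∘ Sum.inr})
    (hinj : ∀ i, InjOn (f i) (A i)) {f' : Fin N → (Fin n → ℝ) → (Fin n → ℝ) →L[ℝ] (Fin n → ℝ)}
    (hf' : ∀ i, ∀ x ∈ A i, HasFDerivWithinAt (f i) (f' i x) (A i) x)
    (hdet : ∀ i, ∀ x ∈ A i, (f' i x).det ^ 2 = 1) {a : Fin n → ℝ} (ha : ∀ j, 0 ≤ a j)
    (hsub : ∀ i, A i ⊆ D₀) (hover : ∀ i i', i ≠ i' → volume (A i ∩ A i') = 0)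
    (hgap : volume (D₀ \ ⋃ i, A i) = 0)
    (hsub' : ∀ i, f i '' A i ⊆ Set.pi Set.univ fun j => Set.Icc 0 (a j))
    (hover' : ∀ i i', i ≠ i' → volume (f i '' A i ∩ f i' '' A i') = 0)
    (hgap' : volume ((Set.pi Set.univ fun j => Set.Icc 0 (a j)) \ ⋃ i, f i '' A i) = 0) :
    IsAlgebraic ℚ (volume D₀).toReal := by
  classical
  have hthin : ∀ s : Set (Fin n → ℝ), volume s = 0 → interior s = ∅ := fun s hs => by
    by_contra hne
    exact (Measure.measure_pos_of_nonempty_interior volume (nonempty_iff_ne_empty.2 hne)).ne' hs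
  choose m c S hS hAS using fun i => soloInformed_isSemialgebraic_real_iff_fibre.1 (hA i)
  choose m' c' S' hS' hfS' using fun i => soloInformed_exists_fibre_of_isSemialgebraic_sum (hf i)
  have hSσ : ∀ i, IsSemialgebraic ℚ ((soloInformedTameMapShapeOf m m' S S').S i) :=
    soloInformedTameMapShapeOf_isSemialgebraic_S S S' hS
  have hGσ : ∀ i, IsSemialgebraic ℚ ((soloInformedTameMapShapeOf m m' S S').G i) :=
    soloInformedTameMapShapeOf_isSemialgebraic_G S S' hS'
  have hpiece : ∀ i, (soloInformedTameMapShapeOf m m' S S').piece i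
      (soloInformedTameMapParam m m' c c' a) = A i := fun i => by
    rw [soloInformedTameMapShapeOf_piece, ← hAS i]
  have hrel : ∀ i x y, (soloInformedTameMapShapeOf m m' S S').rel i
      (soloInformedTameMapParam m m' c c' a) x y ↔ x ∈ A i ∧ f i x = y := fun i x y => by
    rw [soloInformedTameMapShapeOf_rel, ← hfS' i]
    simp only [mem_setOf_eq, Sum.elim_comp_inl, Sum.elim_comp_inr]
  have hside : (soloInformedTameMapShapeOf m m' S S').side
      (soloInformedTameMapParam m m' c c' a) = a := soloInformedTameMapShapeOf_side S S' c c' a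
  have himg : ∀ i, (soloInformedTameMapShapeOf m m' S S').img i
      (soloInformedTameMapParam m m' c c' a) = f i '' A i := fun i => by
    ext y
    simp only [SoloInformedTameMapShape.img, mem_setOf_eq, hpiece, hrel, mem_image]
    constructor
    · rintro ⟨x, hx, -, hxy⟩
      exact ⟨x, hx, hxy⟩
    · rintro ⟨x, hx, hxy⟩
      exact ⟨x, hx, hx, hxy⟩
  have hUA : (⋃ i, (soloInformedTameMapShapeOf m m' S S').piece i
      (soloInformedTameMapParam m m' c c' a)) = ⋃ i, A i := iUnion_congr hpiece
  have hUI : (⋃ i, (soloInformedTameMapShapeOf m m' S S').img i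
      (soloInformedTameMapParam m m' c c' a)) = ⋃ i, f i '' A i := iUnion_congr himg
  have hV : (soloInformedTameMapShapeOf m m' S S').SlackValid D₀
      (soloInformedTameMapParam m m' c c' a) := by
    refine (soloInformedTameMapShapeOf m m' S S').slackValid_iff.2
      ⟨fun j => ?_, fun i => ?_, fun i i' hii' => ?_, ?_, ?_, ?_, ?_, fun i i' hii' => ?_, ?_, ?_,
        ?_⟩
    · rw [hside]
      exact ha j
    · rw [hpiece]
      exact hsub i
    · rw [hpiece, hpiece]
      exact hthin _ (hover i i' hii')
    · rw [hUA]
      exact hthin _ hgap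
    · intro i x hx
      rw [hpiece] at hx
      exact ⟨f i x, (hrel i x _).2 ⟨hx, rfl⟩⟩
    · intro i x y y' _ hy hy'
      rw [hrel] at hy hy'
      rw [← hy.2, ← hy'.2]
    · intro i x y hx hy
      rw [hrel] at hy
      rw [hpiece] at hx
      rw [hside]
      exact hsub' i ⟨x, hx, hy.2⟩
    · rw [himg, himg]
      exact hthin _ (hover' i i' hii')
    · rw [hside, hUI]
      exact hthin _ hgap'
    · intro i x x' y _ _ hy hy'
      rw [hrel] at hy hy'
      exact hinj i hy.1 hy'.1 (hy.2.trans hy'.2.symm)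
    · intro i
      refine (soloInformedTameMapShapeOf m m' S S').diffOK_iff.2 fun x hx => ?_
      rw [hpiece] at hx
      refine ⟨soloInformedCLMEntry (f' i x), ?_, fun e he => ?_⟩
      · rw [soloInformed_det_of_clmEntry]
        exact hdet i x hx
      · obtain ⟨d, hd, hT⟩ := soloInformed_taylor_clmEntry (hf' i x hx) he
        refine ⟨d, hd, fun x' y y' hx' hcl hy hy' j => ?_⟩
        rw [hpiece] at hx'
        rw [hrel] at hy hy'
        rw [← hy.2, ← hy'.2]
        exact hT x' hx' hcl j
  exact (soloInformed_realParameter_barrier_core_fintype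
    ((soloInformedTameMapShapeOf m m' S S').isSemialgebraic_setOf_slackValid hSσ hGσ hD₀)
    (∏ j, (soloInformedTameMapShapeOf m m' S S').Pa j)
    (fun p hp => (soloInformedTameMapShapeOf m m' S S').aeval_prod_side_eq_volume_of_slackValid
      hSσ hGσ hD₀ hp)).2 ⟨_, hV⟩

/-- **COROLLARY SQ with slack (no tame circle squaring up to null sets).** The closed unit disc
cannot be dissected — finitely many `ℝ`-semialgebraic pieces with null overlaps covering it up to
a null set, moved by injective maps with `ℝ`-semialgebraic graphs and within-piece derivatives of
determinant `±1` (isometries, equi-affine maps, area-preserving polynomial shears, …) — onto any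
box up to null sets; in particular not onto the square of side `√π`. [cite: Lindemann1882] -/
theorem soloInformed_no_tame_circle_squaring_slack {N : ℕ} {A : Fin N → Set (Fin 2 → ℝ)}
    (hA : ∀ i, IsSemialgebraic ℝ (A i)) (f : Fin N → (Fin 2 → ℝ) → Fin 2 → ℝ)
    (hf : ∀ i, IsSemialgebraic ℝ
      {v : Fin 2 ⊕ Fin 2 → ℝ | v ∘ Sum.inl ∈ A i ∧ f i (v ∘ Sum.inl) = v ∘ Sum.inr})
    (hinj : ∀ i, InjOn (f i) (A i)) {f' : Fin N → (Fin 2 → ℝ) → (Fin 2 → ℝ) →L[ℝ] (Fin 2 → ℝ)}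
    (hf' : ∀ i, ∀ x ∈ A i, HasFDerivWithinAt (f i) (f' i x) (A i) x)
    (hdet : ∀ i, ∀ x ∈ A i, (f' i x).det ^ 2 = 1) {a : Fin 2 → ℝ} (ha : ∀ j, 0 ≤ a j)
    (hsub : ∀ i, A i ⊆ KZ.piDisc) (hover : ∀ i i', i ≠ i' → volume (A i ∩ A i') = 0)
    (hgap : volume (KZ.piDisc \ ⋃ i, A i) = 0)
    (hsub' : ∀ i, f i '' A i ⊆ Set.pi Set.univ fun j => Set.Icc 0 (a j))
    (hover' : ∀ i i', i ≠ i' → volume (f i '' A i ∩ f i' '' A i') = 0)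
    (hgap' : volume ((Set.pi Set.univ fun j => Set.Icc 0 (a j)) \ ⋃ i, f i '' A i) = 0) :
    False := by
  have h := soloInformed_isAlgebraic_volume_of_tameMapDissection KZ.isSemialgebraic_piDisc hA f hf
    hinj hf' hdet ha hsub hover hgap hsub' hover' hgap'
  rw [KZ.volume_piDisc, ENNReal.toReal_ofReal Real.pi_pos.le] at h
  exact transcendental_pi_holds h

/-- **COROLLARY (sources of transcendental volume admit no tame dissection onto a box, even up
to null sets).** [cite: BochnakCosteRoy1998, §5.2] -/
theorem soloInformed_no_tameMapDissection_of_transcendental_volume {n N : ℕ}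
    {D₀ : Set (Fin n → ℝ)} (hD₀ : IsSemialgebraic ℚ D₀) (hτ : Transcendental ℚ (volume D₀).toReal)
    {A : Fin N → Set (Fin n → ℝ)} (hA : ∀ i, IsSemialgebraic ℝ (A i))
    (f : Fin N → (Fin n → ℝ) → Fin n → ℝ)
    (hf : ∀ i, IsSemialgebraic ℝ
      {v : Fin n ⊕ Fin n → ℝ | v ∘ Sum.inl ∈ A i ∧ f i (v ∘ Sum.inl) = v ∘ Sum.inr})
    (hinj : ∀ i, InjOn (f i) (A i)) {f' : Fin N → (Fin n → ℝ) → (Fin n → ℝ) →L[ℝ] (Fin n → ℝ)}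
    (hf' : ∀ i, ∀ x ∈ A i, HasFDerivWithinAt (f i) (f' i x) (A i) x)
    (hdet : ∀ i, ∀ x ∈ A i, (f' i x).det ^ 2 = 1) {a : Fin n → ℝ} (ha : ∀ j, 0 ≤ a j)
    (hsub : ∀ i, A i ⊆ D₀) (hover : ∀ i i', i ≠ i' → volume (A i ∩ A i') = 0)
    (hgap : volume (D₀ \ ⋃ i, A i) = 0)
    (hsub' : ∀ i, f i '' A i ⊆ Set.pi Set.univ fun j => Set.Icc 0 (a j))
    (hover' : ∀ i i', i ≠ i' → volume (f i '' A i ∩ f i' '' A i') = 0)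
    (hgap' : volume ((Set.pi Set.univ fun j => Set.Icc 0 (a j)) \ ⋃ i, f i '' A i) = 0) :
    False :=
  hτ (soloInformed_isAlgebraic_volume_of_tameMapDissection hD₀ hA f hf hinj hf' hdet ha hsub hover
    hgap hsub' hover' hgap')

end Summit.KontsevichZagierPeriods.KontsevichZagierPeriods.Theorems
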